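import Literature.Combinatorics.Additive.DeZeeuwLineIntersectionBound
import Literature.Computability.AlgebraicComplexity.DeterminantalConormalBoundPlane
import Mathlib.RingTheory.MvPolynomial.Homogeneous
import HarnessLib

/-!
# Lines of an irreducible surface through a point that is not a vertex (Kollár 2015, §7)

Topic `Literature/Combinatorics/Extremal` (the polynomial method in incidence geometry: the
Guth–Katz / Kollár theory of lines on surfaces in three dimensions, of which
`LowDegreeSurfaceThroughLines.lean` is the first step and
`Literature.Combinatorics.Additive.lineIntersection_of_componentBound` the consumer).
Everything in this file is PROVED.

J. Kollár, *Szemerédi–Trotter-type theorems in dimension 3*, Adv. Math. 271 (2015) 30–61,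
§7, proof of **Proposition 55**, first paragraph: "Assume that `p ∈ S` is a point with
infinitely many lines through it. Choose affine coordinates such that `p = (0,0,0)` and `S` has
equation `f(x,y,z) = Σᵢ fᵢ(x,y,z)` where `fᵢ` is homogeneous of degree `i`. A parametrized line
`t ↦ (at, bt, ct)` lies on `S` iff `f(at, bt, ct)` is identically `0`. This holds iff
`fᵢ(a,b,c) = 0` for every `i`. By Bézout, there are either finitely many (in fact `≤ d(d-1)`)
solutions or the `fᵢ` have a common (homogeneous) factor `h(x,y,z)`. Then `h` divides `f` hence
the cone `(h = 0)` is an irreducible component of `S`. This is a contradiction since `S` is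
irreducible and not a cone."

We prove exactly this, over any infinite field `K`:

* `card_lineDirections_le` — if `f ∈ K[X₀,X₁,X₂]` is irreducible of total degree `d` and its
  translate `f(p + ·)` is not a form of degree `d` (i.e. `{f = 0}` is not a cone with vertex
  `p`), then any finite set of pairwise independent directions `v` with `f(p + t v) = 0` for all
  `t ∈ K` has at most `d (d - 1)` elements;
  `card_lines_through_le` — the same for a finite set of lines (affine subspaces of rank `1`)
  through `p` lying on `{f = 0}`.
* Section `Cones` ([Kollar2015, §7, (54)]: "a cone (that is not a plane) has a unique birational
  presentation but all the lines pass through the unique vertex"): `linearForm_dvd_of_eval_eq_zero`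
  (a polynomial vanishing on a plane through the origin is divisible by its linear form),
  `line_through_vertex_of_cone` / `vertex_mem_of_line_on_cone` (every line on an irreducible
  cone of degree `≥ 2` passes through the vertex) and the cone case of the Guth–Katz–Kollár
  component bound, `card_le_one_of_cone`: two disjoint finite families of lines on an
  irreducible cone produce at most one point lying on a line of each (the vertex).

The Bézout step is the set-theoretic projective plane Bézout inequality already in the tree
(`Literature.Computability.AlgebraicComplexity.DeterminantalConormal.planeBezout_card_le`);
"the `fᵢ` have a common factor" is organised factor by factor of the top form `f_d`: each
irreducible factor `r` of `f_d` fails to divide some `fᵢ` (`i < d`), for otherwise `r ∣ f`, so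
`f ~ r` would be a form of degree `d`.

## References
* [Kollar2015] J. Kollár, Adv. Math. 271 (2015) 30–61 — §7, Proposition 55 (proof, ¶1) and
  (54) (special ruled surfaces: cones).
-/

namespace Literature.Combinatorics.Extremal

open MvPolynomial Finset
open Literature.Combinatorics.Additive.DeZeeuw (facs mem_facs irreducible_of_mem_facs
  zero_notMem_facs dvd_of_mem_facs exists_mem_facs_eval_eq_zero sum_totalDegree_facs_le)
open Literature.Computability.AlgebraicComplexity.DeterminantalConormal (planeBezout_card_le
  isHomogeneous_of_dvd_isHomogeneous eval_aeval_eq_eval)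

section Translate

variable {K : Type*} [Field K] {σ : Type*}

/-- Translation `f ↦ f(· + p)` as an algebra endomorphism. [folklore] -/
noncomputable def translate (p : σ → K) : MvPolynomial σ K →ₐ[K] MvPolynomial σ K :=
  aeval fun i => X i + C (p i)

/-- `translate p f` evaluates at `v` to `f(v + p)`. [folklore] -/
theorem eval_translate (p v : σ → K) (f : MvPolynomial σ K) :
    eval v (translate p f) = eval (v + p) f := by
  rw [translate, eval_aeval_eq_eval]
  have : (fun i => eval v (X i + C (p i))) = v + p := _root_.funext fun i => by simp
  rw [this]

/-- Translations compose: `translate (-p) ∘ translate p = id`. [folklore] -/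
theorem translate_neg_comp (p : σ → K) :
    (translate (-p)).comp (translate p) = AlgHom.id K (MvPolynomial σ K) := by
  refine MvPolynomial.algHom_ext fun i => ?_
  simp [translate]

/-- Translation as an algebra automorphism. [folklore] -/
noncomputable def translateEquiv (p : σ → K) : MvPolynomial σ K ≃ₐ[K] MvPolynomial σ K :=
  AlgEquiv.ofAlgHom (translate p) (translate (-p))
    (by simpa using translate_neg_comp (-p)) (translate_neg_comp p)

/-- The underlying map of `translateEquiv`. [folklore] -/
@[simp] theorem translateEquiv_apply (p : σ → K) (f : MvPolynomial σ K) :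
    translateEquiv p f = translate p f := rfl

/-- Substituting affine-linear forms does not raise the total degree. [folklore] -/
theorem totalDegree_aeval_le_of_le_one {τ : Type*} (φ : σ → MvPolynomial τ K)
    (hφ : ∀ i, (φ i).totalDegree ≤ 1) (f : MvPolynomial σ K) :
    (aeval φ f).totalDegree ≤ f.totalDegree := by
  classical
  rw [f.as_sum, map_sum]
  refine (totalDegree_finsetSum _ _).trans (Finset.sup_le fun e he => ?_)
  rw [aeval_monomial, algebraMap_eq]
  refine (totalDegree_mul _ _).trans ?_
  rw [totalDegree_C, zero_add, Finsupp.prod]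
  refine (totalDegree_finsetProd _ _).trans ?_
  refine le_trans (Finset.sum_le_sum fun i _ => (totalDegree_pow _ _).trans
    (Nat.mul_le_mul_left _ (hφ i))) ?_
  simp only [mul_one]
  rw [← f.as_sum]
  exact le_totalDegree he

/-- Translation preserves the total degree. [folklore] -/
theorem totalDegree_translate (p : σ → K) (f : MvPolynomial σ K) :
    (translate p f).totalDegree = f.totalDegree := by
  have h1 : ∀ (q : σ → K) (g : MvPolynomial σ K), (translate q g).totalDegree ≤ g.totalDegree :=
    fun q g => totalDegree_aeval_le_of_le_one _ (fun i => (totalDegree_add _ _).trans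
      (max_le (totalDegree_X _).le (by rw [totalDegree_C]; exact Nat.zero_le _))) g
  refine le_antisymm (h1 p f) ?_
  have h2 := h1 (-p) (translate p f)
  have h3 : translate (-p) (translate p f) = f := by
    have := congrArg (fun φ => φ f) (translate_neg_comp p)
    simpa using this
  rwa [h3] at h2

end Translate

section Directions

variable {K : Type*} [Field K]

/-- **Restriction to a line through `p`, coefficientwise**: if `f(p + t v) = 0` for all `t` in an
infinite field, then every homogeneous component of the translate `f(p + ·)` vanishes at `v`
("`f(at, bt, ct) ≡ 0` iff `fᵢ(a, b, c) = 0` for every `i`").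
[cite: Kollar2015, Proposition 55 (proof, ¶1)] -/
theorem eval_homogeneousComponent_translate_eq_zero [Infinite K] (f : MvPolynomial (Fin 3) K)
    (p v : Fin 3 → K) (h : ∀ t : K, eval (p + t • v) f = 0) (i : ℕ) :
    eval v (homogeneousComponent i (translate p f)) = 0 := by
  set q := translate p f with hq
  -- the univariate polynomial `Σᵢ qᵢ(v) tⁱ`
  set P : Polynomial K := ∑ j ∈ range (q.totalDegree + 1),
    Polynomial.C (eval v (homogeneousComponent j q)) * Polynomial.X ^ j with hP
  have hPeval : ∀ t : K, P.eval t = eval (t • v) q := by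
    intro t
    conv_rhs => rw [← sum_homogeneousComponent q]
    rw [hP, Polynomial.eval_finsetSum, map_sum]
    refine Finset.sum_congr rfl fun j _ => ?_
    rw [Polynomial.eval_mul, Polynomial.eval_C, Polynomial.eval_pow, Polynomial.eval_X,
      Literature.RingTheory.MvPolynomial.eval_smul_of_isHomogeneous
        (homogeneousComponent_isHomogeneous j q), mul_comm]
  have hP0 : P = 0 := by
    refine Polynomial.funext fun t => ?_
    rw [hPeval, Polynomial.eval_zero, hq, eval_translate, add_comm]
    exact h t
  by_cases hi : i ≤ q.totalDegree
  · have hcoeff : P.coeff i = eval v (homogeneousComponent i q) := by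
      rw [hP, Polynomial.finsetSum_coeff]
      rw [Finset.sum_eq_single i]
      · rw [Polynomial.coeff_C_mul_X_pow, if_pos rfl]
      · intro j _ hji
        rw [Polynomial.coeff_C_mul_X_pow, if_neg (Ne.symm hji)]
      · intro hi'
        exact absurd (mem_range.2 (Nat.lt_succ_of_le hi)) hi'
    rw [← hcoeff, hP0, Polynomial.coeff_zero]
  · rw [homogeneousComponent_eq_zero _ _ (not_le.1 hi), map_zero]

/-- **Lines of an irreducible surface through a non-vertex** (Kollár 2015, proof of
Proposition 55, ¶1): if `f ∈ K[X₀,X₁,X₂]` (`K` infinite) is irreducible of total degree `d` and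
its translate `f(p + ·)` is not a form of degree `d` (the surface `{f = 0}` is not a cone with
vertex `p`), then a finite set of pairwise independent directions `v` with `f(p + t v) = 0` for
all `t` has at most `d (d - 1)` elements. [cite: Kollar2015, Proposition 55 (proof, ¶1)] -/
theorem card_lineDirections_le [Infinite K] {f : MvPolynomial (Fin 3) K} (hf : Irreducible f)
    (p : Fin 3 → K) (hcone : ¬ (translate p f).IsHomogeneous f.totalDegree)
    (T : Finset (Fin 3 → K)) (hT0 : ∀ v ∈ T, v ≠ 0)
    (hT : ∀ v ∈ T, ∀ v' ∈ T, v ≠ v' → LinearIndependent K ![v, v'])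
    (hvan : ∀ v ∈ T, ∀ t : K, eval (p + t • v) f = 0) :
    T.card ≤ f.totalDegree * (f.totalDegree - 1) := by
  classical
  set d := f.totalDegree with hd
  set q := translate p f with hq
  -- the translate is irreducible of degree `d`
  have hqirr : Irreducible q := (MulEquiv.irreducible_iff (translateEquiv p)).2 hf
  have hq0 : q ≠ 0 := hqirr.ne_zero
  have hqdeg : q.totalDegree = d := totalDegree_translate p f
  -- its top form `g = q_d` is a nonzero form of degree `d`
  set g := homogeneousComponent d q with hg
  have hghom : g.IsHomogeneous d := homogeneousComponent_isHomogeneous d q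
  have hg0 : g ≠ 0 := by
    obtain ⟨m, hm, hmdeg⟩ : ∃ m ∈ q.support, (m.sum fun _ e => e) = q.totalDegree := by
      obtain ⟨m, hm, h⟩ := Finset.exists_mem_eq_sup q.support (support_nonempty.2 hq0)
        (fun s => s.sum fun _ e => e)
      exact ⟨m, hm, h.symm⟩
    intro h0
    have := congrArg (coeff m) h0
    rw [hg, coeff_homogeneousComponent, coeff_zero, if_pos] at this
    · exact (mem_support_iff.1 hm) this
    · rw [Finsupp.degree_eq_sum]
      rw [Finsupp.sum_fintype _ _ (fun _ => rfl)] at hmdeg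
      rw [hmdeg, hqdeg]
  have hgdeg : g.totalDegree = d := hghom.totalDegree hg0
  -- all components vanish at the directions of `T`
  have hcomp : ∀ v ∈ T, ∀ i, eval v (homogeneousComponent i q) = 0 := fun v hv i =>
    eval_homogeneousComponent_translate_eq_zero f p v (hvan v hv) i
  -- every irreducible factor `r` of `g` misses some component `qᵢ`, `i < d`
  have hmiss : ∀ r ∈ facs g, ∃ i, i < d ∧ ¬ r ∣ homogeneousComponent i q := by
    intro r hr
    have hrirr := irreducible_of_mem_facs hr
    by_contra hall
    push Not at hall
    -- then `r` divides every component of degree `≤ d`, hence `q`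
    have hdvd : r ∣ q := by
      conv_rhs => rw [← sum_homogeneousComponent q, hqdeg]
      refine Finset.dvd_sum fun i hi => ?_
      rcases Nat.lt_or_ge i d with h | h
      · exact hall i h
      · have : i = d := le_antisymm (Nat.le_of_lt_succ (mem_range.1 hi)) h
        rw [this]
        exact dvd_of_mem_facs hr
    -- so `q ~ r` is a form, of degree `d`: a cone
    obtain ⟨u, hu⟩ := hrirr.associated_of_dvd hqirr hdvd
    obtain ⟨c, -, hc⟩ := MvPolynomial.isUnit_iff_eq_C_of_isReduced.1 (Units.isUnit u)
    have hrhom : r.IsHomogeneous r.totalDegree :=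
      isHomogeneous_of_dvd_isHomogeneous hghom hg0 (dvd_of_mem_facs hr)
    have hqhom : q.IsHomogeneous r.totalDegree := by
      rw [← hu, hc, mul_comm]
      exact hrhom.C_mul c
    have : r.totalDegree = d := (hqhom.totalDegree hq0).symm.trans hqdeg
    rw [this] at hqhom
    exact hcone hqhom
  choose! ι hιd hιndvd using hmiss
  -- `T` is covered by the zero sets of the factors of `g`
  have hcover : T ⊆ (facs g).biUnion fun r => T.filter fun v => eval v r = 0 := by
    intro v hv
    have hgv : eval v g = 0 := hcomp v hv d
    obtain ⟨r, hr, hrv⟩ := exists_mem_facs_eval_eq_zero hg0 hgv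
    exact mem_biUnion.2 ⟨r, hr, mem_filter.2 ⟨hv, hrv⟩⟩
  -- Bézout for `r` and the component it misses
  have hpiece : ∀ r ∈ facs g, (T.filter fun v => eval v r = 0).card ≤ r.totalDegree * (d - 1) := by
    intro r hr
    have hrirr := irreducible_of_mem_facs hr
    have hr0 : r ≠ 0 := hrirr.ne_zero
    have hrhom : r.IsHomogeneous r.totalDegree :=
      isHomogeneous_of_dvd_isHomogeneous hghom hg0 (dvd_of_mem_facs hr)
    have hrdeg : r.totalDegree ≠ 0 := by
      intro h0
      rw [totalDegree_eq_zero_iff_eq_C] at h0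
      refine hrirr.not_isUnit ?_
      rw [h0]
      refine (MvPolynomial.isUnit_iff_eq_C_of_isReduced).2 ⟨coeff 0 r, ?_, rfl⟩
      exact isUnit_iff_ne_zero.2 fun hc => hr0 (by rw [h0, hc, C_0])
    have hrel : IsRelPrime r (homogeneousComponent (ι r) q) :=
      (hrirr.isRelPrime_iff_not_dvd).2 (hιndvd r hr)
    refine (planeBezout_card_le hrhom (homogeneousComponent_isHomogeneous (ι r) q) hrdeg hr0 hrel
      _ (fun v hv => (mem_filter.1 hv).2) (fun v hv => hcomp v (mem_filter.1 hv).1 _)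
      (fun v hv => hT0 v (mem_filter.1 hv).1)
      (fun v hv v' hv' hne => hT v (mem_filter.1 hv).1 v' (mem_filter.1 hv').1 hne)).trans ?_
    exact Nat.mul_le_mul_left _ (Nat.le_sub_one_of_lt (hιd r hr))
  -- add up
  calc T.card ≤ ∑ r ∈ facs g, (T.filter fun v => eval v r = 0).card :=
        (card_le_card hcover).trans card_biUnion_le
    _ ≤ ∑ r ∈ facs g, r.totalDegree * (d - 1) := sum_le_sum hpiece
    _ = (∑ r ∈ facs g, r.totalDegree) * (d - 1) := (sum_mul _ _ _).symm
    _ ≤ d * (d - 1) := Nat.mul_le_mul_right _ ((sum_totalDegree_facs_le hg0).trans hgdeg.le)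

end Directions

/-! ### Cones: every line passes through the vertex (Kollár 2015, §7 (54))

Appended: the complementary case of `card_lineDirections_le`. If the translate `f(p + ·)` IS a
form of degree `d ≥ 2` (the surface is a cone with vertex `p`) and `f` is irreducible, then every
line on `{f = 0}` passes through `p` (`line_through_vertex_of_cone`): otherwise `f(p + ·)`
vanishes on the plane spanned by the line and the vertex, hence is divisible by that plane's
linear form (`linearForm_dvd_of_eval_eq_zero`, via `X_zero_dvd_of_eval_eq_zero` and a change of
coordinates), contradicting irreducibility. Together the two results say: through a point `p`
of an irreducible surface of degree `d ≥ 2` pass at most `d(d-1)` lines of the surface, unless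
the surface is a cone with vertex `p`, in which case ALL its lines pass through `p` — the
dichotomy opening the proof of [Kollar2015, Prop. 55] and settling the cone case of the
component bound `GKK` of `Literature.Combinatorics.Additive.lineIntersection_of_componentBound`
(two lines on a cone meet only at the vertex).
-/

section Cones

variable {K : Type*} [Field K]

open scoped Matrix

open Literature.Computability.AlgebraicComplexity.DeterminantalConormal (eval_linSubst
  linSubst_linSubst linSubst_one)

/-- **Vanishing on the hyperplane `z₀ = 0` forces divisibility by `X₀`** (over an infinite
field: the constant coefficient in `X₀` is a polynomial vanishing identically).
[folklore] -/
theorem X_zero_dvd_of_eval_eq_zero [Infinite K] {n : ℕ} (f : MvPolynomial (Fin (n + 1)) K)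
    (h : ∀ z : Fin n → K, eval (Fin.cons 0 z) f = 0) : X 0 ∣ f := by
  set φ := finSuccEquiv K n f with hφ
  have h0 : φ.coeff 0 = 0 := by
    refine MvPolynomial.funext fun z => ?_
    rw [map_zero]
    have := MvPolynomial.eval_eq_eval_mv_eval' z 0 f
    rw [h z] at this
    rw [← Polynomial.coeff_zero_eq_eval_zero, Polynomial.coeff_map] at this
    exact this.symm
  obtain ⟨ψ, hψ⟩ := Polynomial.X_dvd_iff.2 h0
  refine ⟨(finSuccEquiv K n).symm ψ, ?_⟩
  apply (finSuccEquiv K n).injective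
  rw [map_mul, finSuccEquiv_X_zero, AlgEquiv.apply_symm_apply, ← hφ, hψ]

/-- An invertible `3 × 3` matrix with prescribed nonzero first row. [folklore] -/
theorem exists_matrix_row_zero_eq {ν : Fin 3 → K} (hν : ν ≠ 0) :
    ∃ B : Matrix (Fin 3) (Fin 3) K, IsUnit B.det ∧ ∀ j, B 0 j = ν j := by
  obtain ⟨i, hi⟩ := Function.ne_iff.1 hν
  fin_cases i
  · refine ⟨!![ν 0, ν 1, ν 2; 0, 1, 0; 0, 0, 1], ?_, fun j => by fin_cases j <;> rfl⟩
    refine isUnit_iff_ne_zero.2 ?_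
    rw [Matrix.det_fin_three]
    simpa using hi
  · refine ⟨!![ν 0, ν 1, ν 2; 1, 0, 0; 0, 0, 1], ?_, fun j => by fin_cases j <;> rfl⟩
    refine isUnit_iff_ne_zero.2 ?_
    rw [Matrix.det_fin_three]
    simpa using hi
  · refine ⟨!![ν 0, ν 1, ν 2; 1, 0, 0; 0, 1, 0], ?_, fun j => by fin_cases j <;> rfl⟩
    refine isUnit_iff_ne_zero.2 ?_
    rw [Matrix.det_fin_three]
    simpa using hi

/-- **Vanishing on a plane through the origin forces divisibility by its linear form**
(change coordinates so that the plane is `z₀ = 0`). [folklore] -/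
theorem linearForm_dvd_of_eval_eq_zero [Infinite K] {ν : Fin 3 → K} (hν : ν ≠ 0)
    (f : MvPolynomial (Fin 3) K) (h : ∀ z : Fin 3 → K, ν ⬝ᵥ z = 0 → eval z f = 0) :
    (∑ j, C (ν j) * X j) ∣ f := by
  classical
  obtain ⟨B, hB, hrow⟩ := exists_matrix_row_zero_eq hν
  -- `f' = f ∘ B⁻¹` vanishes on `y₀ = 0`
  set f' := aeval (fun i => ∑ j, C (B⁻¹ i j) * X j) f with hf'
  have hf'0 : ∀ z : Fin 2 → K, eval (Fin.cons 0 z) f' = 0 := by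
    intro z
    rw [hf', eval_linSubst]
    refine h _ ?_
    have e : ν ⬝ᵥ (B⁻¹ *ᵥ (Fin.cons 0 z : Fin 3 → K)) = (B *ᵥ (B⁻¹ *ᵥ (Fin.cons 0 z : Fin 3 → K))) 0 := by
      simp only [Matrix.mulVec, dotProduct]
      exact Finset.sum_congr rfl fun j _ => by rw [hrow j]
    rw [e, Matrix.mulVec_mulVec, Matrix.mul_nonsing_inv B hB, Matrix.one_mulVec]
    rfl
  obtain ⟨g, hg⟩ := X_zero_dvd_of_eval_eq_zero f' hf'0
  -- substitute back
  have hback : aeval (fun i => ∑ j, C (B i j) * X j) f' = f := by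
    rw [hf', linSubst_linSubst, Matrix.nonsing_inv_mul B hB, linSubst_one]
  refine ⟨aeval (fun i => ∑ j, C (B i j) * X j) g, ?_⟩
  rw [← hback, hg, map_mul, aeval_X]
  congr 1
  exact Finset.sum_congr rfl fun j _ => by rw [hrow j]

/-- A polynomial vanishing at the points `b + x a`, `x ≠ 0`, of a line vanishes on the whole
line (infinite field). [folklore] -/
theorem eval_line_eq_zero_of_forall_ne_zero [Infinite K] (f : MvPolynomial (Fin 3) K)
    (b a : Fin 3 → K) (h : ∀ x : K, x ≠ 0 → eval (b + x • a) f = 0) (x : K) :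
    eval (b + x • a) f = 0 := by
  set R := MvPolynomial.aeval (fun i => Polynomial.C (b i) + Polynomial.C (a i) * Polynomial.X) f
    with hRdef
  have hR : R = 0 := by
    refine Polynomial.eq_zero_of_infinite_isRoot R ?_
    refine Set.Infinite.mono (s := {x : K | x ≠ 0}) (fun x hx => ?_) ?_
    · show R.IsRoot x
      rw [Polynomial.IsRoot.def, hRdef, eval_aeval_line]
      exact h x hx
    · exact (Set.finite_singleton (0 : K)).infinite_compl
  rw [← eval_aeval_line b a f x]
  show R.eval x = 0
  rw [hR, Polynomial.eval_zero]

/-- In `K³`, a vector orthogonal to `a × w` (for independent `a, w`) lies in the plane spanned by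
`a` and `w` (the triple product `det(z, a, w)` vanishes). [folklore] -/
theorem exists_eq_lin_comb_of_cross_dot {a w z : Fin 3 → K} (haw : LinearIndependent K ![a, w])
    (hz : (a ⨯₃ w) ⬝ᵥ z = 0) : ∃ x y : K, z = x • a + y • w := by
  have hdet : Matrix.det ![z, a, w] = 0 := by
    rw [← triple_product_eq_det, dotProduct_comm]; exact hz
  obtain ⟨c, hc0, hc⟩ := Matrix.exists_vecMul_eq_zero_iff.2 hdet
  have hc' : ∀ j, c 0 * z j + c 1 * a j + c 2 * w j = 0 := fun j => by
    have := congr_fun hc j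
    simpa [Matrix.vecMul, dotProduct, Fin.sum_univ_three] using this
  by_cases h0 : c 0 = 0
  · exfalso
    have hsum : c 1 • a + c 2 • w = 0 := by
      funext j
      have := hc' j
      rw [h0, zero_mul, zero_add] at this
      simpa using this
    obtain ⟨h1, h2⟩ := (LinearIndependent.pair_iff.1 haw) (c 1) (c 2) hsum
    apply hc0
    funext i
    fin_cases i
    · exact h0
    · exact h1
    · exact h2
  · refine ⟨-(c 1 / c 0), -(c 2 / c 0), ?_⟩
    funext j
    have := hc' j
    simp only [Pi.add_apply, Pi.smul_apply, smul_eq_mul]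
    field_simp
    linear_combination this

/-- A linear form `Σ νⱼ Xⱼ` with `ν ≠ 0` is not a unit. [folklore] -/
theorem not_isUnit_linearForm {ν : Fin 3 → K} (hν : ν ≠ 0) :
    ¬ IsUnit (∑ j, C (ν j) * X j : MvPolynomial (Fin 3) K) := by
  intro hu
  obtain ⟨c, -, hc⟩ := MvPolynomial.isUnit_iff_eq_C_of_isReduced.1 hu
  obtain ⟨i, hi⟩ := Function.ne_iff.1 hν
  have e0 := congrArg (eval (0 : Fin 3 → K)) hc
  have e1 := congrArg (eval (Pi.single i 1 : Fin 3 → K)) hc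
  simp only [map_sum, map_mul, eval_C, eval_X, Pi.zero_apply, mul_zero,
    Finset.sum_const_zero] at e0
  simp only [map_sum, map_mul, eval_C, eval_X, Pi.single_apply, mul_ite, mul_one, mul_zero,
    Finset.sum_ite_eq', Finset.mem_univ, if_true] at e1
  exact hi (e1.trans e0.symm)

/-- A linear form is homogeneous of degree `1`. [folklore] -/
theorem isHomogeneous_linearForm (ν : Fin 3 → K) :
    (∑ j, C (ν j) * X j : MvPolynomial (Fin 3) K).IsHomogeneous 1 :=
  IsHomogeneous.sum _ _ _ fun _ _ => isHomogeneous_C_mul_X _ _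

/-- **Every line on an irreducible cone passes through the vertex** (Kollár 2015, §7 (54):
"A cone (that is not a plane) has a unique birational presentation but all the lines pass
through the unique vertex"): if `q` is an irreducible form of degree `d ≥ 2` over an infinite
field and the line `{a + t w}` lies on `{q = 0}`, then `a` and `w` are linearly dependent
(the line passes through the origin). Indeed otherwise `q` vanishes on the plane spanned by
`a, w` (homogeneity), so the plane's linear form divides `q`, contradicting irreducibility.
[cite: Kollar2015, §7, (54) (special ruled surfaces: cones)] -/
theorem not_linearIndependent_of_line_on_cone [Infinite K] {q : MvPolynomial (Fin 3) K}
    (hq : Irreducible q) {d : ℕ} (hqh : q.IsHomogeneous d) (hd : 2 ≤ d) {a w : Fin 3 → K}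
    (h : ∀ t : K, eval (a + t • w) q = 0) : ¬ LinearIndependent K ![a, w] := by
  intro haw
  have hq0 : q ≠ 0 := hq.ne_zero
  -- `q` vanishes on the plane spanned by `a` and `w`
  have hplane : ∀ x y : K, eval (x • a + y • w) q = 0 := by
    have hx : ∀ y x : K, x ≠ 0 → eval (y • w + x • a) q = 0 := by
      intro y x hx
      have e : y • w + x • a = x • (a + (y / x) • w) := by
        rw [smul_add, smul_smul, mul_div_cancel₀ _ hx, add_comm]
      rw [e, Literature.RingTheory.MvPolynomial.eval_smul_of_isHomogeneous hqh, h, mul_zero]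
    intro x y
    rw [add_comm]
    exact eval_line_eq_zero_of_forall_ne_zero q (y • w) a (hx y) x
  -- hence on the plane `{(a × w) · z = 0}`
  set ν := a ⨯₃ w with hν
  have hν0 : ν ≠ 0 := crossProduct_ne_zero_iff_linearIndependent.2 haw
  have hvan : ∀ z : Fin 3 → K, ν ⬝ᵥ z = 0 → eval z q = 0 := by
    intro z hz
    obtain ⟨x, y, rfl⟩ := exists_eq_lin_comb_of_cross_dot haw hz
    exact hplane x y
  -- so the linear form divides the irreducible `q`: `q` is linear
  have hdvd := linearForm_dvd_of_eval_eq_zero hν0 q hvan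
  rcases (hq.dvd_iff).1 hdvd with hu | hassoc
  · exact not_isUnit_linearForm hν0 hu
  · obtain ⟨u, hu⟩ := hassoc.symm
    obtain ⟨c, -, hc⟩ := MvPolynomial.isUnit_iff_eq_C_of_isReduced.1 (Units.isUnit u)
    have hlin : q.IsHomogeneous 1 := by
      rw [← hu, hc, mul_comm]
      exact (isHomogeneous_linearForm ν).C_mul c
    have : d = 1 := hqh.inj_right hlin hq0
    omega

/-- **Lines on an irreducible cone with vertex `p` pass through `p`**: the translated form of
`not_linearIndependent_of_line_on_cone`. [cite: Kollar2015, §7, (54)] -/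
theorem line_through_vertex_of_cone [Infinite K] {f : MvPolynomial (Fin 3) K}
    (hf : Irreducible f) (p : Fin 3 → K) {d : ℕ} (hcone : (translate p f).IsHomogeneous d)
    (hd : 2 ≤ d) {a w : Fin 3 → K} (h : ∀ t : K, eval (a + t • w) f = 0) :
    ¬ LinearIndependent K ![a - p, w] := by
  refine not_linearIndependent_of_line_on_cone
    ((MulEquiv.irreducible_iff (translateEquiv p)).2 hf) hcone hd fun t => ?_
  show eval (a - p + t • w) (translate p f) = 0
  rw [eval_translate, sub_add_eq_add_sub, sub_add_cancel]
  exact h t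

end Cones

section ConeCase

variable {K : Type*} [Field K]

open Literature.Combinatorics.Additive.DeZeeuw (exists_param eq_of_mem_of_mem)

/-- On an irreducible cone of degree `d ≥ 2` with vertex `p` (infinite field), every line lying
on the cone passes through `p` — `line_through_vertex_of_cone` for lines given as affine
subspaces. [cite: Kollar2015, §7, (54)] -/
theorem vertex_mem_of_line_on_cone [Infinite K] {f : MvPolynomial (Fin 3) K}
    (hf : Irreducible f) (p : Fin 3 → K) {d : ℕ} (hcone : (translate p f).IsHomogeneous d)
    (hd : 2 ≤ d) (ℓ : AffineSubspace K (Fin 3 → K)) (hℓ : Module.finrank K ℓ.direction = 1)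
    (hℓf : ∀ z ∈ ℓ, eval z f = 0) : p ∈ ℓ := by
  obtain ⟨uv, hv, hmem⟩ := exists_param ℓ hℓ
  have hline : ∀ t : K, eval (uv.1 + t • uv.2) f = 0 :=
    fun t => hℓf _ ((hmem _).2 ⟨t, rfl⟩)
  have hdep := line_through_vertex_of_cone hf p hcone hd hline
  rw [LinearIndependent.pair_iff] at hdep
  push Not at hdep
  obtain ⟨a, b, hab, hne⟩ := hdep
  have ha : a ≠ 0 := by
    intro ha0
    rw [ha0, zero_smul, zero_add, smul_eq_zero] at hab
    rcases hab with hb | hv0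
    · exact hne ha0 hb
    · exact hv hv0
  rw [hmem]
  refine ⟨b / a, ?_⟩
  have h1 : a • (uv.1 - p) = -(b • uv.2) := eq_neg_of_add_eq_zero_left hab
  have h2 : uv.1 - p = -(b / a) • uv.2 := by
    calc uv.1 - p = a⁻¹ • (a • (uv.1 - p)) := by rw [smul_smul, inv_mul_cancel₀ ha, one_smul]
      _ = -(b / a) • uv.2 := by rw [h1, smul_neg, smul_smul, ← neg_smul, div_eq_inv_mul]
  calc p = uv.1 - (uv.1 - p) := by abel
    _ = uv.1 + (b / a) • uv.2 := by rw [h2, neg_smul, sub_neg_eq_add]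

/-- **The cone case of the Guth–Katz–Kollár component bound**: on an irreducible cone of
degree `d ≥ 2` over an infinite field, two disjoint finite families `L, M` of lines produce at
most ONE point lying on a line of each family — the vertex (all lines pass through it, and two
distinct lines share at most one point). [cite: Kollar2015, §7, (54)] -/
theorem card_le_one_of_cone [Infinite K] {f : MvPolynomial (Fin 3) K} (hf : Irreducible f)
    (p : Fin 3 → K) {d : ℕ} (hcone : (translate p f).IsHomogeneous d) (hd : 2 ≤ d)
    (L M : Finset (AffineSubspace K (Fin 3 → K)))
    (hL : ∀ ℓ ∈ L, Module.finrank K ℓ.direction = 1)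
    (hM : ∀ m ∈ M, Module.finrank K m.direction = 1) (hLM : Disjoint L M)
    (hLf : ∀ ℓ ∈ L, ∀ z ∈ ℓ, eval z f = 0) (hMf : ∀ m ∈ M, ∀ z ∈ m, eval z f = 0)
    (I : Finset (Fin 3 → K)) (hI : ∀ z ∈ I, (∃ ℓ ∈ L, z ∈ ℓ) ∧ (∃ m ∈ M, z ∈ m)) :
    I.card ≤ 1 := by
  have key : ∀ z ∈ I, z = p := by
    intro z hz
    obtain ⟨⟨ℓ, hℓ, hzℓ⟩, ⟨m, hm, hzm⟩⟩ := hI z hz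
    have hne : ℓ ≠ m := fun h => Finset.disjoint_left.1 hLM hℓ (h ▸ hm)
    exact eq_of_mem_of_mem (hL ℓ hℓ) (hM m hm) hne hzℓ hzm
      (vertex_mem_of_line_on_cone hf p hcone hd ℓ (hL ℓ hℓ) (hLf ℓ hℓ))
      (vertex_mem_of_line_on_cone hf p hcone hd m (hM m hm) (hMf m hm))
  exact Finset.card_le_one.2 fun z hz z' hz' => by rw [key z hz, key z' hz']

end ConeCase

section LinesThroughPoint

variable {K : Type*} [Field K]

open Literature.Combinatorics.Additive.DeZeeuw (exists_param)

/-- **At most `d(d-1)` lines of an irreducible surface through a non-vertex point** — the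
affine-subspace form of `card_lineDirections_le` (Kollár 2015, proof of Prop. 55, ¶1): if
`f` is irreducible of degree `d` over an infinite field and `{f = 0}` is not a cone with vertex
`p` (the translate `f(p + ·)` is not a form of degree `d`), then at most `d(d-1)` lines through
`p` lie on `{f = 0}`. [cite: Kollar2015, Proposition 55 (proof, ¶1)] -/
theorem card_lines_through_le [Infinite K] {f : MvPolynomial (Fin 3) K} (hf : Irreducible f)
    (p : Fin 3 → K) (hcone : ¬ (translate p f).IsHomogeneous f.totalDegree)
    (Λ : Finset (AffineSubspace K (Fin 3 → K)))
    (hΛ1 : ∀ ℓ ∈ Λ, Module.finrank K ℓ.direction = 1) (hpΛ : ∀ ℓ ∈ Λ, p ∈ ℓ)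
    (hvan : ∀ ℓ ∈ Λ, ∀ z ∈ ℓ, eval z f = 0) :
    Λ.card ≤ f.totalDegree * (f.totalDegree - 1) := by
  classical
  -- every line of `Λ` is `{p + t v}` for a nonzero direction `v`
  have hdir : ∀ ℓ ∈ Λ, ∃ v : Fin 3 → K, v ≠ 0 ∧ ∀ z, z ∈ ℓ ↔ ∃ t : K, z = p + t • v := by
    intro ℓ hℓ
    obtain ⟨uv, hv, hmem⟩ := exists_param ℓ (hΛ1 ℓ hℓ)
    obtain ⟨t₀, ht₀⟩ := (hmem p).1 (hpΛ ℓ hℓ)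
    refine ⟨uv.2, hv, fun z => ?_⟩
    rw [hmem z, ht₀]
    constructor
    · rintro ⟨t, rfl⟩
      exact ⟨t - t₀, by rw [sub_smul]; abel⟩
    · rintro ⟨t, rfl⟩
      exact ⟨t + t₀, by rw [add_smul]; abel⟩
  choose! dir hdir0 hmem using hdir
  -- distinct lines through `p` have independent directions
  have hind : ∀ ℓ ∈ Λ, ∀ ℓ' ∈ Λ, ℓ ≠ ℓ' → LinearIndependent K ![dir ℓ, dir ℓ'] := by
    intro ℓ hℓ ℓ' hℓ' hne
    rw [LinearIndependent.pair_iff]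
    by_contra h
    push Not at h
    obtain ⟨a, b, hab, hab0⟩ := h
    apply hne
    -- one direction is a multiple of the other; both lines pass through `p`
    have key : ∀ {m m' : AffineSubspace K (Fin 3 → K)}, m ∈ Λ → m' ∈ Λ → ∀ c : K,
        dir m = c • dir m' → m = m' := by
      intro m m' hm hm' c hc
      have hc0 : c ≠ 0 := by
        rintro rfl
        rw [zero_smul] at hc
        exact hdir0 m hm hc
      ext z
      rw [hmem m hm, hmem m' hm']
      constructor
      · rintro ⟨t, rfl⟩
        exact ⟨t * c, by rw [hc, smul_smul]⟩
      · rintro ⟨t, rfl⟩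
        exact ⟨t / c, by rw [hc, smul_smul, div_mul_cancel₀ _ hc0]⟩
    by_cases ha : a = 0
    · have hb : b ≠ 0 := hab0 ha
      rw [ha, zero_smul, zero_add, smul_eq_zero] at hab
      exact absurd (hab.resolve_left hb) (hdir0 ℓ' hℓ')
    · -- `dir ℓ = -(b/a) • dir ℓ'`
      refine key hℓ hℓ' (-(b / a)) ?_
      have h1 : a • dir ℓ = -(b • dir ℓ') := eq_neg_of_add_eq_zero_left hab
      calc dir ℓ = a⁻¹ • (a • dir ℓ) := by rw [smul_smul, inv_mul_cancel₀ ha, one_smul]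
        _ = -(b / a) • dir ℓ' := by rw [h1, smul_neg, smul_smul, ← neg_smul, div_eq_inv_mul]
  have hinj : Set.InjOn dir Λ := by
    intro ℓ hℓ ℓ' hℓ' h
    by_contra hne
    have h0 := hind ℓ hℓ ℓ' hℓ' hne
    rw [LinearIndependent.pair_iff] at h0
    have := (h0 1 (-1) (by rw [h, one_smul, neg_one_smul, add_neg_cancel])).1
    exact one_ne_zero this
  -- apply the direction count
  rw [← Finset.card_image_of_injOn hinj]
  refine card_lineDirections_le hf p hcone (Λ.image dir) ?_ ?_ ?_
  · simp only [Finset.mem_image]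
    rintro _ ⟨ℓ, hℓ, rfl⟩
    exact hdir0 ℓ hℓ
  · simp only [Finset.mem_image]
    rintro _ ⟨ℓ, hℓ, rfl⟩ _ ⟨ℓ', hℓ', rfl⟩ hne
    exact hind ℓ hℓ ℓ' hℓ' fun h => hne (by rw [h])
  · simp only [Finset.mem_image]
    rintro _ ⟨ℓ, hℓ, rfl⟩ t
    exact hvan ℓ hℓ _ ((hmem ℓ hℓ _).2 ⟨t, rfl⟩)

end LinesThroughPoint

end Literature.Combinatorics.Extremal
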